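import Summits.KontsevichZagierPeriods.KontsevichZagierPeriods.Theses.FurushoPentagon
import Summits.KontsevichZagierPeriods.KontsevichZagierPeriods.Theses.OctahedralSymmetry
import Summits.KontsevichZagierPeriods.KontsevichZagierPeriods.Theorems.MzvKernelInKZ.Negative.ScalingDivision

/-!
# `IntegerDivision` (stmt-KontsevichZagierPeriods-3934, route `FurushoPentagon`, support item #9;
verbatim twin in route `OctahedralSymmetry`)

Division by a positive integer is a DERIVED rule of the Kontsevich–Zagier calculus:
`0 < n → n • c ∈ KZ.relations → c ∈ KZ.relations` for every formal representation `c`.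

Proof: this is the tree's `MzvKernelInKZ.Negative.mem_relations_of_nsmul_mem`
(`Theorems/MzvKernelInKZ/Negative/ScalingDivision.lean`): the scaling endomorphism `KZ.scale a`
(`[σ, f] ↦ [σ, a·f]`, `a` real algebraic) preserves `KZ.relations`, and modulo relations
`scale 1 ≡ id`, `scale (a·b) ≡ scale a ∘ scale b`, `scale n ≡ n • ·` (integrand additivity); so
`c ≡ scale (n⁻¹) (scale n c) ≡ scale (n⁻¹) (n • c) ∈ relations`.
The hypothesis `0 < n` is necessary (`n = 0` would put `[π]` in relations; refuter note on the item).

Sources: M. Kontsevich, D. Zagier, *Periods* (2001), §1.2 (rules (1b), (2)).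
-/

namespace Summit.KontsevichZagierPeriods.FurushoPentagon

/-- **Integer division is a derived rule** (route item `FurushoPentagon.IntegerDivision`, stmt-3934):
for every `c : KZ.FormalRep` and `0 < n`, `n • c ∈ KZ.relations → c ∈ KZ.relations`.
Immediate from `MzvKernelInKZ.Negative.mem_relations_of_nsmul_mem` (scaling endomorphisms of the
calculus). [folklore] -/
theorem integerDivision_proof :
    Summit.KontsevichZagierPeriods.KontsevichZagierPeriods.Theses.FurushoPentagon.IntegerDivision := by
  unfold Summit.KontsevichZagierPeriods.KontsevichZagierPeriods.Theses.FurushoPentagon.IntegerDivision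
  intro c n hn h
  exact Summit.KontsevichZagierPeriods.MzvKernelInKZ.Negative.mem_relations_of_nsmul_mem hn h

/-- The verbatim twin filed by route `OctahedralSymmetry` (`OctahedralSymmetry.IntegerDivision`, same
item stmt-3934): `0 < n → n • c ∈ KZ.relations → c ∈ KZ.relations`. [folklore] -/
theorem octahedralSymmetry_integerDivision_proof :
    Summit.KontsevichZagierPeriods.KontsevichZagierPeriods.Theses.OctahedralSymmetry.IntegerDivision := by
  unfold Summit.KontsevichZagierPeriods.KontsevichZagierPeriods.Theses.OctahedralSymmetry.IntegerDivision
  intro c n hn h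
  exact Summit.KontsevichZagierPeriods.MzvKernelInKZ.Negative.mem_relations_of_nsmul_mem hn h

end Summit.KontsevichZagierPeriods.FurushoPentagon
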